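import Mathlib
import Summits.KontsevichZagierPeriods.KontsevichZagierPeriods.Theorems.SoloInformedCoonsBox
import HarnessLib

/-!
# SoloInformed — the Coons patch in the plane: edges, continuity, semialgebraicity

File I2c₁ of the (HT) step (`SoloInformedNashHT`) of the solo-informed programme (support for the
Coons cell `soloInformed_kappaPath_coons`, file `SoloInformedCoonsCell`).

For the Coons patch `h(s,t)` of four boundary curves `c_B, c_T, c_L, c_R : ℝ → ℂ`
(`SoloInformedCoonsPatch`): the edge values of `∂ₛh`, `∂ₜh` (they are the edge velocities
`c_B′, c_T′, c_L′, c_R′`); continuity of `h, ∂ₛh, ∂ₜh, ∂ₛ∂ₜh` as functions of `z = (s,t) ∈ ℝ²` on a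
set `W` whose coordinates stay in an interval `J` where the data are continuous; and
`ℚ`-semialgebraicity of `h` on `W` (real and imaginary parts, `SoloInformedReImSA`) when the four
curves are `ℚ`-semialgebraic and the corners algebraic (the blending weights are polynomial).

References: Huber–Wüstholz, *Transcendence and linear relations of 1-periods* (2022), §7.2;
Bochnak–Coste–Roy, *Real algebraic geometry* (1998), §2.2.
-/

noncomputable section

open scoped BigOperators Topology
open Set Metric MvPolynomial
open Literature.NumberTheory.Transcendental Literature.NumberTheory.Transcendental.KZ
open Literature.NumberTheory.Transcendental.CurvePeriods
open Literature.ModelTheory.ExponentialFields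

namespace Summit.KontsevichZagierPeriods.KontsevichZagierPeriods.Theorems

/-! ## 1. Edge values of the partial derivatives of the Coons patch -/

section CoonsEdges

variable {cB cT cL cR dB dT dL dR : ℝ → ℂ}

/-- `∂ₛh(s, 0) = c_B′(s)`. -/
theorem soloInformed_coonsDs_bottom (h00 : cL 0 = cB 0) (h10 : cR 0 = cB 1) (s : ℝ) :
    soloInformedCoonsDs cB cT cL cR dB dT s 0 = dB s := by
  simp only [soloInformedCoonsDs, h00, h10]
  push_cast
  ring

/-- `∂ₛh(s, 1) = c_T′(s)`. -/
theorem soloInformed_coonsDs_top (h01 : cL 1 = cT 0) (h11 : cR 1 = cT 1) (s : ℝ) :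
    soloInformedCoonsDs cB cT cL cR dB dT s 1 = dT s := by
  simp only [soloInformedCoonsDs, h01, h11]
  push_cast
  ring

/-- `∂ₜh(0, t) = c_L′(t)`. -/
theorem soloInformed_coonsDt_left (t : ℝ) : soloInformedCoonsDt cB cT dL dR 0 t = dL t := by
  simp only [soloInformedCoonsDt]
  push_cast
  ring

/-- `∂ₜh(1, t) = c_R′(t)`. -/
theorem soloInformed_coonsDt_right (t : ℝ) : soloInformedCoonsDt cB cT dL dR 1 t = dR t := by
  simp only [soloInformedCoonsDt]
  push_cast
  ring

end CoonsEdges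

/-! ## 2. Continuity and semialgebraicity of the Coons expressions on `ℝ²` -/

section CoonsPlane

variable {cB cT cL cR dB dT dL dR : ℝ → ℂ} {J : Set ℝ} {W : Set (Fin 2 → ℝ)}

/-- A real polynomial weight, cast to `ℂ`, is continuous on `ℝ²`. -/
private theorem cell_cont_w (p : (Fin 2 → ℝ) → ℝ) (hp : Continuous p) :
    ContinuousOn (fun z : Fin 2 → ℝ => ((p z : ℝ) : ℂ)) W :=
  (Complex.continuous_ofReal.comp hp).continuousOn

/-- A one-variable function read through a coordinate is continuous. -/
private theorem cell_cont_c {f : ℝ → ℂ} (hf : ContinuousOn f J) (i : Fin 2)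
    (hW : ∀ z ∈ W, z i ∈ J) : ContinuousOn (fun z : Fin 2 → ℝ => f (z i)) W :=
  hf.comp (continuous_apply i).continuousOn hW

/-- The Coons patch `z ↦ h(z 0, z 1)` is continuous where the edge curves are. -/
theorem soloInformed_continuousOn_coons₂ (h0 : ∀ z ∈ W, z 0 ∈ J) (h1 : ∀ z ∈ W, z 1 ∈ J)
    (hB : ContinuousOn cB J) (hT : ContinuousOn cT J) (hL : ContinuousOn cL J)
    (hR : ContinuousOn cR J) :
    ContinuousOn (fun z : Fin 2 → ℝ => soloInformedCoons cB cT cL cR (z 0) (z 1)) W := by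
  have c0 : Continuous fun z : Fin 2 → ℝ => z 0 := continuous_apply 0
  have c1 : Continuous fun z : Fin 2 → ℝ => z 1 := continuous_apply 1
  have s1 := (cell_cont_w (W := W) (fun z => 1 - z 1) (continuous_const.sub c1)).mul
    (cell_cont_c hB 0 h0)
  have s2 := (cell_cont_w (W := W) (fun z => z 1) c1).mul (cell_cont_c hT 0 h0)
  have s3 := (cell_cont_w (W := W) (fun z => 1 - z 0) (continuous_const.sub c0)).mul
    (cell_cont_c hL 1 h1)
  have s4 := (cell_cont_w (W := W) (fun z => z 0) c0).mul (cell_cont_c hR 1 h1)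
  have k1 := (cell_cont_w (W := W) (fun z => (1 - z 0) * (1 - z 1))
    ((continuous_const.sub c0).mul (continuous_const.sub c1))).mul
    (continuousOn_const (c := cB 0))
  have k2 := (cell_cont_w (W := W) (fun z => z 0 * (1 - z 1))
    (c0.mul (continuous_const.sub c1))).mul (continuousOn_const (c := cB 1))
  have k3 := (cell_cont_w (W := W) (fun z => (1 - z 0) * z 1)
    ((continuous_const.sub c0).mul c1)).mul (continuousOn_const (c := cT 0))
  have k4 := (cell_cont_w (W := W) (fun z => z 0 * z 1) (c0.mul c1)).mul
    (continuousOn_const (c := cT 1))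
  exact ((((s1.add s2).add s3).add s4).sub (((k1.add k2).add k3).add k4)).congr fun z _ => rfl

/-- `z ↦ ∂ₛh(z 0, z 1)` is continuous where the data are. -/
theorem soloInformed_continuousOn_coonsDs₂ (h0 : ∀ z ∈ W, z 0 ∈ J) (h1 : ∀ z ∈ W, z 1 ∈ J)
    (hL : ContinuousOn cL J) (hR : ContinuousOn cR J) (hdB : ContinuousOn dB J)
    (hdT : ContinuousOn dT J) :
    ContinuousOn (fun z : Fin 2 → ℝ => soloInformedCoonsDs cB cT cL cR dB dT (z 0) (z 1)) W := by
  have c0 : Continuous fun z : Fin 2 → ℝ => z 0 := continuous_apply 0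
  have c1 : Continuous fun z : Fin 2 → ℝ => z 1 := continuous_apply 1
  have s1 := (cell_cont_w (W := W) (fun z => 1 - z 1) (continuous_const.sub c1)).mul
    (cell_cont_c hdB 0 h0)
  have s2 := (cell_cont_w (W := W) (fun z => z 1) c1).mul (cell_cont_c hdT 0 h0)
  have s3 := cell_cont_c (W := W) hL 1 h1
  have s4 := cell_cont_c (W := W) hR 1 h1
  have k1 := (cell_cont_w (W := W) (fun z => 1 - z 1) (continuous_const.sub c1)).neg.mul
    (continuousOn_const (c := cB 0))
  have k2 := (cell_cont_w (W := W) (fun z => 1 - z 1) (continuous_const.sub c1)).mul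
    (continuousOn_const (c := cB 1))
  have k3 := (cell_cont_w (W := W) (fun z => z 1) c1).mul (continuousOn_const (c := cT 0))
  have k4 := (cell_cont_w (W := W) (fun z => z 1) c1).mul (continuousOn_const (c := cT 1))
  exact ((((s1.add s2).sub s3).add s4).sub (((k1.add k2).sub k3).add k4)).congr fun z _ => rfl

/-- `z ↦ ∂ₜh(z 0, z 1)` is continuous where the data are. -/
theorem soloInformed_continuousOn_coonsDt₂ (h0 : ∀ z ∈ W, z 0 ∈ J) (h1 : ∀ z ∈ W, z 1 ∈ J)
    (hB : ContinuousOn cB J) (hT : ContinuousOn cT J) (hdL : ContinuousOn dL J)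
    (hdR : ContinuousOn dR J) :
    ContinuousOn (fun z : Fin 2 → ℝ => soloInformedCoonsDt cB cT dL dR (z 0) (z 1)) W := by
  have c0 : Continuous fun z : Fin 2 → ℝ => z 0 := continuous_apply 0
  have c1 : Continuous fun z : Fin 2 → ℝ => z 1 := continuous_apply 1
  have s1 := (cell_cont_c (W := W) hB 0 h0).neg
  have s2 := cell_cont_c (W := W) hT 0 h0
  have s3 := (cell_cont_w (W := W) (fun z => 1 - z 0) (continuous_const.sub c0)).mul
    (cell_cont_c hdL 1 h1)
  have s4 := (cell_cont_w (W := W) (fun z => z 0) c0).mul (cell_cont_c hdR 1 h1)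
  have k1 := (cell_cont_w (W := W) (fun z => 1 - z 0) (continuous_const.sub c0)).neg.mul
    (continuousOn_const (c := cB 0))
  have k2 := (cell_cont_w (W := W) (fun z => z 0) c0).mul (continuousOn_const (c := cB 1))
  have k3 := (cell_cont_w (W := W) (fun z => 1 - z 0) (continuous_const.sub c0)).mul
    (continuousOn_const (c := cT 0))
  have k4 := (cell_cont_w (W := W) (fun z => z 0) c0).mul (continuousOn_const (c := cT 1))
  exact ((((s1.add s2).add s3).add s4).sub (((k1.sub k2).add k3).add k4)).congr fun z _ => rfl

/-- `z ↦ ∂ₜ∂ₛh(z 0, z 1)` is continuous where the data are. -/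
theorem soloInformed_continuousOn_coonsDst₂ (h0 : ∀ z ∈ W, z 0 ∈ J) (h1 : ∀ z ∈ W, z 1 ∈ J)
    (hdB : ContinuousOn dB J) (hdT : ContinuousOn dT J) (hdL : ContinuousOn dL J)
    (hdR : ContinuousOn dR J) :
    ContinuousOn
      (fun z : Fin 2 → ℝ => soloInformedCoonsDst cB cT dB dT dL dR (z 0) (z 1)) W := by
  have s1 := (cell_cont_c (W := W) hdB 0 h0).neg
  have s2 := cell_cont_c (W := W) hdT 0 h0
  have s3 := cell_cont_c (W := W) hdL 1 h1
  have s4 := cell_cont_c (W := W) hdR 1 h1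
  exact ((((s1.add s2).sub s3).add s4).sub
    (continuousOn_const (c := cB 0 - cB 1 - cT 0 + cT 1))).congr fun z _ => rfl

/-- **The Coons patch is `ReImSA` on a `ℚ`-semialgebraic set** when the edge curves are (read
through the coordinates) and the four corner values are algebraic. [BCR 1998, §2.2] -/
theorem soloInformed_reImSA_coons₂ {S : Set (Fin 1 → ℝ)} (hs : IsSemialgebraic ℚ W)
    (h0 : ∀ z ∈ W, (fun _ : Fin 1 => z 0) ∈ S) (h1 : ∀ z ∈ W, (fun _ : Fin 1 => z 1) ∈ S)
    (hB : SoloInformedReImSA S (fun t => cB (t 0))) (hT : SoloInformedReImSA S (fun t => cT (t 0)))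
    (hL : SoloInformedReImSA S (fun t => cL (t 0))) (hR : SoloInformedReImSA S (fun t => cR (t 0)))
    (aB0 : IsAlgebraic ℚ (cB 0)) (aB1 : IsAlgebraic ℚ (cB 1)) (aT0 : IsAlgebraic ℚ (cT 0))
    (aT1 : IsAlgebraic ℚ (cT 1)) :
    SoloInformedReImSA W (fun z : Fin 2 → ℝ => soloInformedCoons cB cT cL cR (z 0) (z 1)) := by
  have hB' : SoloInformedReImSA W (fun z : Fin 2 → ℝ => cB (z 0)) := hB.comp_coord hs 0 h0
  have hT' : SoloInformedReImSA W (fun z : Fin 2 → ℝ => cT (z 0)) := hT.comp_coord hs 0 h0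
  have hL' : SoloInformedReImSA W (fun z : Fin 2 → ℝ => cL (z 1)) := hL.comp_coord hs 1 h1
  have hR' : SoloInformedReImSA W (fun z : Fin 2 → ℝ => cR (z 1)) := hR.comp_coord hs 1 h1
  have w : ∀ p : MvPolynomial (Fin 2) ℚ,
      SoloInformedReImSA W (fun z : Fin 2 → ℝ => ((aeval z p : ℝ) : ℂ)) := fun p =>
    SoloInformedReImSA.ofReal hs (isSemialgebraicFunOn_aeval hs p)
  have s1 := (w (1 - X 1)).mul hB'
  have s2 := (w (X 1)).mul hT'
  have s3 := (w (1 - X 0)).mul hL'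
  have s4 := (w (X 0)).mul hR'
  have k1 := (w ((1 - X 0) * (1 - X 1))).mul (SoloInformedReImSA.const hs aB0)
  have k2 := (w (X 0 * (1 - X 1))).mul (SoloInformedReImSA.const hs aB1)
  have k3 := (w ((1 - X 0) * X 1)).mul (SoloInformedReImSA.const hs aT0)
  have k4 := (w (X 0 * X 1)).mul (SoloInformedReImSA.const hs aT1)
  have h := SoloInformedReImSA.sub hs (((s1.add s2).add s3).add s4) (((k1.add k2).add k3).add k4)
  refine h.congr fun z _ => ?_
  simp only [soloInformedCoons, soloInformedCoonsCorner, map_sub, map_mul, map_one, aeval_X]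

end CoonsPlane

end Summit.KontsevichZagierPeriods.KontsevichZagierPeriods.Theorems
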